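import Mathlib
import HarnessLib
import Summits.ValiantsHypothesis.ValiantsHypothesis.Theorems.DepthWindowDialAtTwo
import Summits.ValiantsHypothesis.ValiantsHypothesis.Theorems.SuccinctLiftFiniteFields

/-!
# SuccinctLift — hygiene: the `§4 (w6)` wall statements «every wall holds at slopes κ < 1/2» are decided at `n = 2`
# (census instrument DIALFORM-AUDIT-v1, decomp-valiant workshop cycle 1; support for the WALL-D item
# `stmt-ValiantsHypothesis-23721` `AlgDescentLog3` of route `SuccinctLift`)

Critic ruling 705 (2026-08-30) recorded, after `DepthWindowDialAtTwo` (lens 5), that the DIAL-FORM per-rungs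
`DepthWindow.perHardGrowingDepth` / `DepthWindow.perHardBelowHalf` are kernel theorems whose STATEMENTS are decided
at `n = 2` (`L₃ 2 = 0`, a product-free circuit has total degree `≤ 1 < 2 = deg per_2`).  The census audit of every
declaration carrying an `L₃ = ⌊log₂⌊log₂⌊log₂ ·⌋⌋⌋` depth budget (100 declarations in the `DepthWindow`,
`SuccinctLift`, `DefinabilityGap` depth-ladder and `DecompCycle1B` files) finds ONE further family that inherits
the same witness through a depth FUNCTION argument: `SuccinctLiftFiniteFields` §4 —
`not_perEasyComplex_belowHalf`, `not_perEasyAlg_belowHalf`, `not_perEasyIntAdv_belowHalf`,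
`not_perEasyPolyAdv_belowHalf`, `not_perEasyCF_belowHalf` and `walls_belowHalf` (all stated for the budget
`fun n ↦ p · L₃ n / q` under `2 p < q`, all one-line corollaries of `perHardBelowHalf`).  This file proves the same
six statements for an ARBITRARY budget `Δ` with `Δ 2 = 0` and hence for EVERY slope `p / q` with no hypothesis
(slope `100` included): the dial points `PerEasyComplex Δ`, `PerEasyAlg Δ`, `PerEasyIntAdv Δ`, `PerEasyPolyAdv Δ`,
`PerEasyCF Δ` are all FALSE at `n = 2`, so the three walls `AlgConstantLiftAt Δ` (`K_alg`), `HeightLiftAt Δ` (`H`),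
`AlgDescentAt Δ` (`D`) — implications between negated dial points — hold vacuously.  Consequently the record
sentence «the walls K_alg, H, D hold at every slope κ < 1/2 (kernel)» is TRUE BY DEGENERATE WITNESS and is not
evidence about the walls' open window; the content-bearing wall statements are the route items at budget
`L₃ n + 1` (`HeightLiftLog3`, `AlgDescentLog3`, `AlgConstantLiftLog3`, … — budget `≥ 1` at every `n`, NOT affected)
and any future wall rung should be typed in ROBUST form (`∀ K c m₀, ∃ n ≥ m₀, …` at budget `⌊p L₃ n / q⌋ + K`, or
at a constant budget `Δ₀ ≥ 1`).  Honest framing: hygiene only; no item changes; `VP ≠ VNP` untouched.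

References: [LimayeSrinivasanTavenas2025, Cor. 4] (the dial the §4 statements cite); [Burgisser2000, §4.1]
(the constants dial `D0 ⊆ D1 ⊆ D2 ⊆ Dtop`); [AndrewsForbes2022, proof of Lemma 6.7] (`deg ≤ s^Δ`).
-/

set_option linter.dupNamespace false

namespace Summit.ValiantsHypothesis.ValiantsHypothesis.Theorems.SuccinctLiftWallsDialAtTwo

open Literature.Computability.AlgebraicComplexity
open Summit.ValiantsHypothesis.ValiantsHypothesis.Theorems

/-- `Dtop` is empty at any budget vanishing at `n = 2`: no `c` makes every `per_n` computable over `ℂ` in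
product-depth `Δ n` with `≤ n ^ c + c` wires, witnessed by `n = 2` alone
(`DepthWindowDialAtTwo.perDial_of_budget_two_eq_zero`). [folklore] -/
theorem not_perEasyComplex_of_budget_two (Δ : ℕ → ℕ) (h : Δ 2 = 0) : ¬ SuccinctLift.PerEasyComplex Δ :=
  DepthWindowDialAtTwo.perDial_of_budget_two_eq_zero Δ h

/-- … hence the algebraic-constants dial point is empty too (`PerEasyComplex ↔ PerEasyAlg`,
`SuccinctLift.perEasyComplex_iff_perEasyAlg`). [cite: Burgisser2000, §4.1] -/
theorem not_perEasyAlg_of_budget_two (Δ : ℕ → ℕ) (h : Δ 2 = 0) : ¬ SuccinctLift.PerEasyAlg Δ :=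
  fun hA => not_perEasyComplex_of_budget_two Δ h ((SuccinctLift.perEasyComplex_iff_perEasyAlg Δ).mpr hA)

/-- … and the integer-advice dial point `D2`. [cite: Burgisser2000, §4.1] -/
theorem not_perEasyIntAdv_of_budget_two (Δ : ℕ → ℕ) (h : Δ 2 = 0) : ¬ SuccinctLift.PerEasyIntAdv Δ :=
  fun hI => not_perEasyComplex_of_budget_two Δ h (SuccinctLift.perEasyComplex_of_perEasyIntAdv Δ hI)

/-- … and the polynomial-height-advice dial point `D1`. [cite: Burgisser2000, §4.1] -/
theorem not_perEasyPolyAdv_of_budget_two (Δ : ℕ → ℕ) (h : Δ 2 = 0) : ¬ SuccinctLift.PerEasyPolyAdv Δ :=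
  fun hP => not_perEasyIntAdv_of_budget_two Δ h (SuccinctLift.perEasyIntAdv_of_perEasyPolyAdv Δ hP)

/-- … and the constant-free dial point `D0`. [cite: Burgisser2000, §4.1] -/
theorem not_perEasyCF_of_budget_two (Δ : ℕ → ℕ) (h : Δ 2 = 0) : ¬ SuccinctLift.PerEasyCF Δ :=
  fun hC => not_perEasyPolyAdv_of_budget_two Δ h (SuccinctLift.perEasyPolyAdv_of_perEasyCF Δ hC)

/-- **The three walls hold VACUOUSLY at every budget vanishing at `n = 2`**: `K_alg = AlgConstantLiftAt Δ`,
`H = HeightLiftAt Δ`, `D = AlgDescentAt Δ` are implications whose conclusion `¬ PerEasyAlg Δ` / `¬ PerEasyIntAdv Δ`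
is already true. [cite: Burgisser2000, §4.1] -/
theorem walls_of_budget_two (Δ : ℕ → ℕ) (h : Δ 2 = 0) :
    SuccinctLift.AlgConstantLiftAt Δ ∧ SuccinctLift.HeightLiftAt Δ ∧ SuccinctLift.AlgDescentAt Δ :=
  ⟨fun _ => not_perEasyAlg_of_budget_two Δ h,
    SuccinctLift.heightLiftAt_of_perHardAlg _ (not_perEasyAlg_of_budget_two Δ h),
    SuccinctLift.algDescentAt_of_perHardAlg _ (not_perEasyAlg_of_budget_two Δ h)⟩

/-- The slope budgets `⌊p · L₃ n / q⌋` vanish at `n = 2` for EVERY `p q` (`L₃ 2 = 0`,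
`DepthWindowDialAtTwo.log3_two`). [folklore] -/
theorem slopeBudget_two (p q : ℕ) : p * Nat.log 2 (Nat.log 2 (Nat.log 2 2)) / q = 0 := by
  simp [DepthWindowDialAtTwo.log3_two]

/-- **Every slope, no hypothesis**: the statement of `SuccinctLift.walls_belowHalf p q` (landed under `2 p < q`,
read as «the walls hold at every slope κ < 1/2») holds for ALL `p q : ℕ` — slope `p / q = 100` included — by the
witness `n = 2`; as a STATEMENT it therefore says nothing about the walls below, at, or above slope `1/2`.
[folklore] -/
theorem walls_all_slopes (p q : ℕ) :
    SuccinctLift.AlgConstantLiftAt (fun n => p * Nat.log 2 (Nat.log 2 (Nat.log 2 n)) / q) ∧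
      SuccinctLift.HeightLiftAt (fun n => p * Nat.log 2 (Nat.log 2 (Nat.log 2 n)) / q) ∧
      SuccinctLift.AlgDescentAt (fun n => p * Nat.log 2 (Nat.log 2 (Nat.log 2 n)) / q) :=
  walls_of_budget_two _ (slopeBudget_two p q)

/-- Likewise the five dial-point statements of §4 hold at every slope. [folklore] -/
theorem not_perEasyCF_all_slopes (p q : ℕ) :
    ¬ SuccinctLift.PerEasyCF fun n => p * Nat.log 2 (Nat.log 2 (Nat.log 2 n)) / q :=
  not_perEasyCF_of_budget_two _ (slopeBudget_two p q)

/-- The landed `§4` statement, re-derived WITHOUT using `perHardBelowHalf` and without its hypothesis playing any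
role (the hypothesis is discarded). [folklore] -/
example (p q : ℕ) (_hpq : 2 * p < q) :
    SuccinctLift.AlgConstantLiftAt (fun n => p * Nat.log 2 (Nat.log 2 (Nat.log 2 n)) / q) ∧
      SuccinctLift.HeightLiftAt (fun n => p * Nat.log 2 (Nat.log 2 (Nat.log 2 n)) / q) ∧
      SuccinctLift.AlgDescentAt (fun n => p * Nat.log 2 (Nat.log 2 (Nat.log 2 n)) / q) :=
  walls_all_slopes p q

/-- … and the same statement elaborates from the landed theorem (statement identity check). [folklore] -/
example (p q : ℕ) (hpq : 2 * p < q) :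
    SuccinctLift.AlgConstantLiftAt (fun n => p * Nat.log 2 (Nat.log 2 (Nat.log 2 n)) / q) ∧
      SuccinctLift.HeightLiftAt (fun n => p * Nat.log 2 (Nat.log 2 (Nat.log 2 n)) / q) ∧
      SuccinctLift.AlgDescentAt (fun n => p * Nat.log 2 (Nat.log 2 (Nat.log 2 n)) / q) :=
  SuccinctLift.walls_belowHalf p q hpq

/-- Slope `100` (product depth `100 · L₃ n`, far ABOVE the crux depth `L₃ n + 1` for large `n`): still a theorem —
the witness is `n = 2`, not a lower bound. [folklore] -/
example :
    SuccinctLift.AlgConstantLiftAt (fun n => 100 * Nat.log 2 (Nat.log 2 (Nat.log 2 n)) / 1) ∧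
      SuccinctLift.HeightLiftAt (fun n => 100 * Nat.log 2 (Nat.log 2 (Nat.log 2 n)) / 1) ∧
      SuccinctLift.AlgDescentAt (fun n => 100 * Nat.log 2 (Nat.log 2 (Nat.log 2 n)) / 1) :=
  walls_all_slopes 100 1

/-- NOT affected: at the route's budget `L₃ n + 1 ≥ 1` the `n = 2` witness is unavailable — `per_2` HAS a
product-depth-`1` circuit — so the route items `HeightLiftLog3` / `AlgDescentLog3` / `AlgConstantLiftLog3` keep
their content; recorded here only as the arithmetic fact that the route budget never vanishes. [folklore] -/
theorem routeBudget_pos (n : ℕ) : 1 ≤ Nat.log 2 (Nat.log 2 (Nat.log 2 n)) + 1 := Nat.le_add_left 1 _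

end Summit.ValiantsHypothesis.ValiantsHypothesis.Theorems.SuccinctLiftWallsDialAtTwo
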